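import Mathlib
import HarnessLib
import Summits.HubbardSuperconductivity.HubbardSuperconductivity.Theorems.KLProgrammeKLRegimeTorusL1ThirdDifferencesMoment
import Summits.HubbardSuperconductivity.HubbardSuperconductivity.Theorems.KLProgrammeKLRegimeTorusL1SecondDifferencesSpace
import Summits.HubbardSuperconductivity.HubbardSuperconductivity.Theorems.KLProgrammeKLRegimeTorusL1MixedDifferencesMoment

/-!
# Route `KLProgramme` — engine / VL support (route (L2), ADDITIVE weight, FIRST MOMENT): the SPACE-ONLY (fixed-time, «sectional») corollary of the
# weighted `ℓ²` master lemma — the `(1 + s·|ỹ|₁)`-weighted `ℓ¹` norm of a character sum on `(ℤ/L)²` from sup, support and ANISOTROPIC third differences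

Cell `gate-hubbard-kl`, seat p3 (g11).  k3c4-p1's per-scale data list for the Λ-scaled two-volume step (KL STATUS 2026-08-28T00:46:49Z, M3b-j (ii);
`…TwoVolumeSrcSectorScaleSuccMinS`, hypothesis `hsecW'`) reads ONE ε-free datum of the fine SECTORISED covariance: the sectional (fixed time and label)
Λ-scaled row `Σ_y ‖C′ X′ ((t,y),ℓ)‖·(1 + Λ·tnorm(x′ − y)) ≤ eW′`.  For a sector propagator the isotropic sectional machinery (`…TwoVolumeSectionalMoment`,
plain pulled-back symbol) loses the `Λ^{−1/2}` tangential extent of the sector; the anisotropic `ℓ²` route of `…TorusL1ThirdDifferencesMoment`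
(`sum_wt_norm_charSum_le_of_third_differences`, integer frame `(v⊥, v)`, direction-dependent rates) keeps it.  At a fixed time the symbol is a function
of the spatial momentum only, so — exactly as k3c2-p3's `…TorusL1SecondDifferencesSpace` does at order two — the master lemma on `(ℤ/1)¹ × (ℤ/L)²`
(trivial time torus: its character is `1`, its difference direction is `0`) gives

* **`sum_wt_norm_charSum_space_le_of_third_differences`** — for `G : (ℤ/L)² → ℂ` with `‖G‖ ≤ A₀`, `#{G ≠ 0} ≤ N_s`, third differences
  `‖Δ³_{eᵢ}G‖ ≤ A₀(4/(s₁L))³`, `‖Δ³_{v⊥}G‖ ≤ A₀(4/(s₂L))³`, `‖Δ³_{v}G‖ ≤ A₀(4/(s₃L))³` (`v ≠ 0`, `2(|v₁|+|v₂|)R₀ < L`), and any `s₀ > 0`: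
  `Σ_y (1 + s₁|ỹ₁| + s₁|ỹ₂|)·‖Σ_k χ_k(y) G(k)‖ ≤ √(32768(1/s₀+1)[C_w²·4(2√2/(s₂|v|)+2)(2√2/(s₃|v|)+2) + 16(1/s₁+1)²/(1+s₁R₀)])·√(21·L²·N_s)·A₀`
  (`s₀` only enters the constant; take it large);
* **`sum_wt_norm_charSum_space_le_of_mixed_differences`** — the same for the MIXED-orders master `sum_wt_norm_charSum_le_of_mixed_differences`
  (…TorusL1MixedDifferencesMoment: second differences along `v` at the anisotropic rate `s₃`, third at `s₃′`), which is the one the model's per-pair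
  chain `…SectorSlicePairMoment.slicePairWt_charSum_l1_le` uses.

Everything is proved; no definitions, no named facts; nothing about the model is asserted. [folklore]
References: G. Benfatto, A. Giuliani, V. Mastropietro, Ann. Henri Poincaré 7 (2006) 809–898, Lemma 2.2 (2.52), §2.8 (2.81) footnote ¹.
-/

noncomputable section

namespace Summit.HubbardSuperconductivity.HubbardSuperconductivity.Theorems.TorusFourierL2

set_option linter.dupNamespace false -- summit = problem name (single-conjunct summit), D-0017

open Finset Complex Literature.Probability.LatticeModels
open scoped Real

section Space

variable {L : ℕ} [NeZero L]

/-- **The space-only weighted `ℓ¹` bound (one position moment) from anisotropic third differences** (see the module docstring).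
[cite: BenfattoGiulianiMastropietro2006, Lemma 2.2 (2.52), §2.8 (2.81)] -/
theorem sum_wt_norm_charSum_space_le_of_third_differences (G : TorusSite 2 L → ℂ)
    (v : Fin 2 → ℤ) (hv : v ≠ 0) {s₀ s₁ s₂ s₃ : ℝ} (hs₀ : 0 < s₀) (hs₁ : 0 < s₁) (hs₂ : 0 < s₂) (hs₃ : 0 < s₃)
    {R₀ : ℕ} (hR₀ : 2 * (|v 0| + |v 1|) * (R₀ : ℤ) < L) {A₀ : ℝ} (hA₀ : 0 ≤ A₀) {Ns : ℕ}
    (hsupp : (univ.filter fun k => G k ≠ 0).card ≤ Ns) (hsup : ∀ k, ‖G k‖ ≤ A₀)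
    (h₁ : ∀ k (i : Fin 2), ‖(fwdDiff (Pi.single i (1 : ZMod L) : TorusSite 2 L))^[3] G k‖ ≤ A₀ * (4 / (s₁ * L)) ^ 3)
    (h₂ : ∀ k, ‖(fwdDiff (fun j => ((![-v 1, v 0] j : ℤ) : ZMod L)))^[3] G k‖ ≤ A₀ * (4 / (s₂ * L)) ^ 3)
    (h₃ : ∀ k, ‖(fwdDiff (fun j => ((v j : ℤ) : ZMod L)))^[3] G k‖ ≤ A₀ * (4 / (s₃ * L)) ^ 3) :
    ∑ y : TorusSite 2 L, (1 + s₁ * |(((y 0).valMinAbs : ℤ) : ℝ)| + s₁ * |(((y 1).valMinAbs : ℤ) : ℝ)|) *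
        ‖∑ k : TorusSite 2 L, torusChar k y • G k‖ ≤
      Real.sqrt (32768 * (1 / s₀ + 1) *
          ((1 + 2 * Real.sqrt 2 * s₁ / (s₂ * Real.sqrt ((v 0 : ℝ) ^ 2 + (v 1 : ℝ) ^ 2)) +
              2 * Real.sqrt 2 * s₁ / (s₃ * Real.sqrt ((v 0 : ℝ) ^ 2 + (v 1 : ℝ) ^ 2))) ^ 2 *
            (4 * ((2 * Real.sqrt 2 / (s₂ * Real.sqrt ((v 0 : ℝ) ^ 2 + (v 1 : ℝ) ^ 2)) + 2) *
              (2 * Real.sqrt 2 / (s₃ * Real.sqrt ((v 0 : ℝ) ^ 2 + (v 1 : ℝ) ^ 2)) + 2)))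
            + 16 * (1 / s₁ + 1) ^ 2 / (1 + s₁ * R₀))) *
        Real.sqrt (21 * (L : ℝ) ^ 2 * Ns) * A₀ := by
  classical
  -- lift to the product with the trivial time torus `(ℤ/1)¹`
  set G' : TorusSite 1 1 × TorusSite 2 L → ℂ := fun q => G q.2 with hG'
  -- support and sup
  have hsupp' : (univ.filter fun q : TorusSite 1 1 × TorusSite 2 L => G' q ≠ 0).card ≤ Ns := by
    refine le_trans ?_ hsupp
    refine Finset.card_le_card_of_injOn Prod.snd (fun q hq => ?_) (fun q₁ hq₁ q₂ hq₂ h => ?_)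
    · simp only [coe_filter, mem_univ, true_and, Set.mem_setOf_eq] at hq ⊢; exact hq
    · exact Prod.ext (Subsingleton.elim _ _) h
  have hsup' : ∀ q, ‖G' q‖ ≤ A₀ := fun q => hsup q.2
  -- time direction: the step is `0` on the trivial torus, so the third difference vanishes
  have htime0 : (((fun _ : Fin 1 => (1 : ZMod 1)), (0 : TorusSite 2 L)) : TorusSite 1 1 × TorusSite 2 L) = ((0 : TorusSite 1 1), (0 : TorusSite 2 L)) :=
    Prod.ext (Subsingleton.elim _ _) rfl
  have h₀' : ∀ q, ‖(fwdDiff ((fun _ : Fin 1 => (1 : ZMod 1)), (0 : TorusSite 2 L)))^[3] G' q‖ ≤ A₀ * (4 / (s₀ * (1 : ℕ))) ^ 3 := by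
    intro q
    rw [htime0, fwdDiff_iter_snd G 0 3 q]
    have hz : ∀ g : TorusSite 2 L → ℂ, fwdDiff (0 : TorusSite 2 L) g = 0 := fun g => by funext y; simp [fwdDiff]
    rw [Function.iterate_succ_apply', hz, Pi.zero_apply, norm_zero]
    positivity
  -- space directions
  have h₁' : ∀ q (i : Fin 2), ‖(fwdDiff ((0 : TorusSite 1 1), (Pi.single i (1 : ZMod L) : TorusSite 2 L)))^[3] G' q‖ ≤
      A₀ * (4 / (s₁ * L)) ^ 3 := fun q i => by rw [fwdDiff_iter_snd G _ 3 q]; exact h₁ q.2 i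
  have h₂' : ∀ q, ‖(fwdDiff ((0 : TorusSite 1 1), (fun j => ((![-v 1, v 0] j : ℤ) : ZMod L))))^[3] G' q‖ ≤ A₀ * (4 / (s₂ * L)) ^ 3 :=
    fun q => by rw [fwdDiff_iter_snd G _ 3 q]; exact h₂ q.2
  have h₃' : ∀ q, ‖(fwdDiff ((0 : TorusSite 1 1), (fun j => ((v j : ℤ) : ZMod L))))^[3] G' q‖ ≤ A₀ * (4 / (s₃ * L)) ^ 3 :=
    fun q => by rw [fwdDiff_iter_snd G _ 3 q]; exact h₃ q.2
  have hmain := sum_wt_norm_charSum_le_of_third_differences G' v hv hs₀ hs₁ hs₂ hs₃ hR₀ hA₀ hsupp' hsup' h₀' h₁' h₂' h₃'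
  -- the left-hand side is the space sum (the time coordinate of the trivial torus has `valMinAbs = 0`)
  have hval : ∀ a : TorusSite 1 1, |(((a 0).valMinAbs : ℤ) : ℝ)| = 0 := fun a => by
    have h0 : a 0 = 0 := Subsingleton.elim _ _
    rw [h0, ZMod.valMinAbs_zero]; simp
  have hLHS : ∑ z : TorusSite 1 1 × TorusSite 2 L,
      (1 + s₀ * |(((z.1 0).valMinAbs : ℤ) : ℝ)| + s₁ * |(((z.2 0).valMinAbs : ℤ) : ℝ)| + s₁ * |(((z.2 1).valMinAbs : ℤ) : ℝ)|) *
        ‖∑ q : TorusSite 1 1 × TorusSite 2 L, (torusChar q.1 z.1 * torusChar q.2 z.2) • G' q‖ =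
      ∑ y : TorusSite 2 L, (1 + s₁ * |(((y 0).valMinAbs : ℤ) : ℝ)| + s₁ * |(((y 1).valMinAbs : ℤ) : ℝ)|) *
        ‖∑ k : TorusSite 2 L, torusChar k y • G k‖ := by
    rw [Fintype.sum_prod_type, Fintype.sum_unique]
    refine sum_congr rfl fun z _ => ?_
    rw [hval, mul_zero, add_zero, Fintype.sum_prod_type, Fintype.sum_unique]
    congr 2
    refine sum_congr rfl fun k _ => ?_
    have h1 : (default : TorusSite 1 1) = 0 := Subsingleton.elim _ _
    simp [hG', h1]
  rw [hLHS] at hmain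
  refine hmain.trans (le_of_eq ?_)
  congr 2
  push_cast
  ring_nf

end Space

section SpaceMixed

variable {L : ℕ} [NeZero L]

/-- **The space-only weighted `ℓ¹` bound, MIXED orders along the tangent** (the `P = 1` corollary of `sum_wt_norm_charSum_le_of_mixed_differences`,
the master lemma the model's per-pair chain `…SectorSlicePairMoment` actually uses): third differences along the axes / `v⊥` / `v` at the isotropic rates
`s₁ / s₂ / s₃′` and SECOND differences along `v` at the anisotropic rate `s₃`.
[cite: BenfattoGiulianiMastropietro2006, Lemma 2.2 (2.52)–(2.55), §2.8 (2.81)] -/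
theorem sum_wt_norm_charSum_space_le_of_mixed_differences (G : TorusSite 2 L → ℂ)
    (v : Fin 2 → ℤ) (hv : v ≠ 0) {s₀ s₁ s₂ s₃ s₃' : ℝ} (hs₀ : 0 < s₀) (hs₁ : 0 < s₁) (hs₂ : 0 < s₂) (hs₃ : 0 < s₃) (hs₃' : 0 < s₃')
    {R₀ : ℕ} (hR₀ : 2 * (|v 0| + |v 1|) * (R₀ : ℤ) < L) {A₀ : ℝ} (hA₀ : 0 ≤ A₀) {Ns : ℕ}
    (hsupp : (univ.filter fun k => G k ≠ 0).card ≤ Ns) (hsup : ∀ k, ‖G k‖ ≤ A₀)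
    (h₁ : ∀ k (i : Fin 2), ‖(fwdDiff (Pi.single i (1 : ZMod L) : TorusSite 2 L))^[3] G k‖ ≤ A₀ * (4 / (s₁ * L)) ^ 3)
    (h₂ : ∀ k, ‖(fwdDiff (fun j => ((![-v 1, v 0] j : ℤ) : ZMod L)))^[3] G k‖ ≤ A₀ * (4 / (s₂ * L)) ^ 3)
    (h₃ : ∀ k, ‖(fwdDiff (fun j => ((v j : ℤ) : ZMod L)))^[2] G k‖ ≤ A₀ * (4 / (s₃ * L)) ^ 2)
    (h₃' : ∀ k, ‖(fwdDiff (fun j => ((v j : ℤ) : ZMod L)))^[3] G k‖ ≤ A₀ * (4 / (s₃' * L)) ^ 3) :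
    ∑ y : TorusSite 2 L, (1 + s₁ * |(((y 0).valMinAbs : ℤ) : ℝ)| + s₁ * |(((y 1).valMinAbs : ℤ) : ℝ)|) *
        ‖∑ k : TorusSite 2 L, torusChar k y • G k‖ ≤
      Real.sqrt (524288 * (1 / s₀ + 1) *
          ((1 + 2 * Real.sqrt 2 * s₁ / (s₂ * Real.sqrt ((v 0 : ℝ) ^ 2 + (v 1 : ℝ) ^ 2)) +
              2 * Real.sqrt 2 * s₁ / (s₃' * Real.sqrt ((v 0 : ℝ) ^ 2 + (v 1 : ℝ) ^ 2))) ^ 2 *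
            ((2 * Real.sqrt 2 / (s₂ * Real.sqrt ((v 0 : ℝ) ^ 2 + (v 1 : ℝ) ^ 2)) + 2) *
              (2 * Real.sqrt 2 / (s₃ * Real.sqrt ((v 0 : ℝ) ^ 2 + (v 1 : ℝ) ^ 2)) + 2))
            + (1 / s₁ + 1) ^ 2 / (1 + s₁ * R₀))) *
        Real.sqrt (24 * (L : ℝ) ^ 2 * Ns) * A₀ := by
  classical
  set G' : TorusSite 1 1 × TorusSite 2 L → ℂ := fun q => G q.2 with hG'
  have hsupp' : (univ.filter fun q : TorusSite 1 1 × TorusSite 2 L => G' q ≠ 0).card ≤ Ns := by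
    refine le_trans ?_ hsupp
    refine Finset.card_le_card_of_injOn Prod.snd (fun q hq => ?_) (fun q₁ hq₁ q₂ hq₂ h => ?_)
    · simp only [coe_filter, mem_univ, true_and, Set.mem_setOf_eq] at hq ⊢; exact hq
    · exact Prod.ext (Subsingleton.elim _ _) h
  have hsup' : ∀ q, ‖G' q‖ ≤ A₀ := fun q => hsup q.2
  have htime0 : (((fun _ : Fin 1 => (1 : ZMod 1)), (0 : TorusSite 2 L)) : TorusSite 1 1 × TorusSite 2 L) = ((0 : TorusSite 1 1), (0 : TorusSite 2 L)) :=
    Prod.ext (Subsingleton.elim _ _) rfl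
  have h₀' : ∀ q, ‖(fwdDiff ((fun _ : Fin 1 => (1 : ZMod 1)), (0 : TorusSite 2 L)))^[3] G' q‖ ≤ A₀ * (4 / (s₀ * (1 : ℕ))) ^ 3 := by
    intro q
    rw [htime0, fwdDiff_iter_snd G 0 3 q]
    have hz : ∀ g : TorusSite 2 L → ℂ, fwdDiff (0 : TorusSite 2 L) g = 0 := fun g => by funext y; simp [fwdDiff]
    rw [Function.iterate_succ_apply', hz, Pi.zero_apply, norm_zero]
    positivity
  have h₁' : ∀ q (i : Fin 2), ‖(fwdDiff ((0 : TorusSite 1 1), (Pi.single i (1 : ZMod L) : TorusSite 2 L)))^[3] G' q‖ ≤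
      A₀ * (4 / (s₁ * L)) ^ 3 := fun q i => by rw [fwdDiff_iter_snd G _ 3 q]; exact h₁ q.2 i
  have h₂' : ∀ q, ‖(fwdDiff ((0 : TorusSite 1 1), (fun j => ((![-v 1, v 0] j : ℤ) : ZMod L))))^[3] G' q‖ ≤ A₀ * (4 / (s₂ * L)) ^ 3 :=
    fun q => by rw [fwdDiff_iter_snd G _ 3 q]; exact h₂ q.2
  have h₃_ : ∀ q, ‖(fwdDiff ((0 : TorusSite 1 1), (fun j => ((v j : ℤ) : ZMod L))))^[2] G' q‖ ≤ A₀ * (4 / (s₃ * L)) ^ 2 :=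
    fun q => by rw [fwdDiff_iter_snd G _ 2 q]; exact h₃ q.2
  have h₃'_ : ∀ q, ‖(fwdDiff ((0 : TorusSite 1 1), (fun j => ((v j : ℤ) : ZMod L))))^[3] G' q‖ ≤ A₀ * (4 / (s₃' * L)) ^ 3 :=
    fun q => by rw [fwdDiff_iter_snd G _ 3 q]; exact h₃' q.2
  have hmain := sum_wt_norm_charSum_le_of_mixed_differences G' v hv hs₀ hs₁ hs₂ hs₃ hs₃' hR₀ hA₀ hsupp' hsup' h₀' h₁' h₂' h₃_ h₃'_
  have hval : ∀ a : TorusSite 1 1, |(((a 0).valMinAbs : ℤ) : ℝ)| = 0 := fun a => by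
    have h0 : a 0 = 0 := Subsingleton.elim _ _
    rw [h0, ZMod.valMinAbs_zero]; simp
  have hLHS : ∑ z : TorusSite 1 1 × TorusSite 2 L,
      (1 + s₀ * |(((z.1 0).valMinAbs : ℤ) : ℝ)| + s₁ * |(((z.2 0).valMinAbs : ℤ) : ℝ)| + s₁ * |(((z.2 1).valMinAbs : ℤ) : ℝ)|) *
        ‖∑ q : TorusSite 1 1 × TorusSite 2 L, (torusChar q.1 z.1 * torusChar q.2 z.2) • G' q‖ =
      ∑ y : TorusSite 2 L, (1 + s₁ * |(((y 0).valMinAbs : ℤ) : ℝ)| + s₁ * |(((y 1).valMinAbs : ℤ) : ℝ)|) *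
        ‖∑ k : TorusSite 2 L, torusChar k y • G k‖ := by
    rw [Fintype.sum_prod_type, Fintype.sum_unique]
    refine sum_congr rfl fun z _ => ?_
    rw [hval, mul_zero, add_zero, Fintype.sum_prod_type, Fintype.sum_unique]
    congr 2
    refine sum_congr rfl fun k _ => ?_
    have h1 : (default : TorusSite 1 1) = 0 := Subsingleton.elim _ _
    simp [hG', h1]
  rw [hLHS] at hmain
  refine hmain.trans (le_of_eq ?_)
  congr 2
  push_cast
  ring_nf

end SpaceMixed

end Summit.HubbardSuperconductivity.HubbardSuperconductivity.Theorems.TorusFourierL2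

end
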